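/-
Copyright (c) 2026 the pub-hodgecm-mathlib formalisation cell (harness21).  Prover seat hodgecm-mathlib-K2Liu-p02 (g4), Track B «K2-LIT» ∕
hLiu418 #184♮, socket #42F′ road I (LEAD F0P6-plan (g11) rulings «M-155k» (2)–(4), «M-155p»; WORDS-42F organ «κ-transport»), 2026-09-04.
-/
import Literature.NumberTheory.Weil1964.DoublingCayleyMover
import Literature.NumberTheory.Weil1964.AdelicMetaplecticGenerators
import Literature.NumberTheory.GelbartRogawski1991.LocalDoubledWeylElementCayleyMover

/-!
# Crux `HLiu418`, road `K2_Liu`, organ «κ-transport» (S): the Cayley mover re-enumerated into `Sp_{2(n+n)}(K)` on `Fin (n + n)`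

Cell `hodgecm-mathlib`, crux item hLiu418 = `stmt-HodgeConjecture-24832`; squad K2 ∕ K2Liu, prover K2Liu-p02 (g4).  THEOREMS ONLY (no `def` ∕
instance ∕ notation ∕ named-fact hypothesis ∕ `sorry`); lane `--supports stmt-HodgeConjecture-24832 --as helper` (count-neutral).

The Ikeda datum of the first-term identity (WORDS-42F ∕ M-155k (2): `Mbig := ω(r_F^𝔻(m(g₀) · κ_big))`, ★ `K2LiuIkedaMapDefs.ikedaMap`) reads
the ★ Cayley mover `cayleyMover K ι : Matrix.symplecticGroup (ι ⊕ ι) K` of ★ `Weil1964.DoublingCayleyMover` (Darboux index `(ι ⊕ ι) ⊕ (ι ⊕ ι)`)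
inside the doubled datum's `Matrix.symplecticGroup (Fin (n + n)) K` (the source of ★ `rFD` ∕ `ratThetaLiftCont`), i.e. RE-ENUMERATED along
`e₂ = finSumFinEquiv : Fin n ⊕ Fin n ≃ Fin (n + n)` on both Lagrangian halves.  This file is that transport:

* §1 `reindex_sumCongr_map` (relabelling along `e ⊕ e` commutes with entrywise ring maps); the relabelling of `Sp(ι, R)` into `Sp(κ, R)` itself
  is ★ `LocalSplitting.reindex_sumCongr_mem_symplecticGroup`;
* §2 **`reindex_cayleyMoverMatrix_mem_symplecticGroup`**: `κ_n := reindex (e₂ ⊕ e₂) (e₂ ⊕ e₂) κ ∈ Matrix.symplecticGroup (Fin (n + n)) K`;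
  `reindex_cayleyMoverMatrix_map`: `κ_n` is defined over `ℤ[½]` (fixed by ring maps, ★ `cayleyMoverMatrix_map`) — so its adelic image is the
  `mapHom` of the rational `κ_n` (`mapHom_reindex_cayleyMover`), the shape ★ `ratSp` ∕ `ratThetaLiftCont` consume.

HONEST LABEL.  Count-neutral helper; it pays nothing by itself: `HC_CM` is proved only modulo the 7 printed citations (2 remaining named inputs:
hLiu418 = `stmt-HodgeConjecture-24832`, h413 = `stmt-HodgeConjecture-24833`) until rung 0 closes.
References: [Kudla1994] §3 (the doubled space, its Lagrangians and the swapping element); [MoeglinVignerasWaldspurger1987] Chap. 2 II.2.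
-/

set_option autoImplicit false
-- the mandated namespace repeats the single-problem summit's segment (`HodgeConjecture.HodgeConjecture`)
set_option linter.dupNamespace false

noncomputable section

open scoped Matrix
open Matrix
open Literature.NumberTheory.Weil1964 Literature.RepresentationTheory.HeisenbergGroup
open Literature.RepresentationTheory.HeisenbergGroup.SymplecticMatrix
open Literature.NumberTheory.GelbartRogawski1991.UnitaryDualPair.LocalSplitting (reindex_sumCongr_mem_symplecticGroup)

namespace Summit.HodgeConjecture.HodgeConjecture.Cruxes.HLiu418.K2LiuCayleyMoverFin

/-! ## §1 Relabelling a symplectic group along `e ⊕ e` -/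

section Reindex

variable {R : Type*} [CommRing R] {ι κ : Type*} (e : ι ≃ κ)

/-- relabelling commutes with entrywise ring maps. [cite: MoeglinVignerasWaldspurger1987, Chap. 2 II.2] -/
theorem reindex_sumCongr_map {S : Type*} [CommRing S] (f : R →+* S) (M : Matrix (ι ⊕ ι) (ι ⊕ ι) R) :
    (Matrix.reindex (e.sumCongr e) (e.sumCongr e) M).map f = Matrix.reindex (e.sumCongr e) (e.sumCongr e) (M.map f) :=
  rfl

end Reindex

/-! ## §2 The Cayley mover on `Fin (n + n)` -/

section Cayley

variable (K : Type*) [CommRing K] [Invertible (2 : K)] (n : ℕ)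

/-- **`κ_n ∈ Sp_{2(n+n)}(K)`**: the Cayley mover of ★ `DoublingCayleyMover`, re-enumerated along `e₂ ⊕ e₂`, lies in the doubled datum's
`Matrix.symplecticGroup (Fin (n + n)) K`. [cite: Kudla1994, §3] -/
theorem reindex_cayleyMoverMatrix_mem_symplecticGroup :
    Matrix.reindex ((finSumFinEquiv (m := n) (n := n)).sumCongr (finSumFinEquiv (m := n) (n := n)))
        ((finSumFinEquiv (m := n) (n := n)).sumCongr (finSumFinEquiv (m := n) (n := n))) (cayleyMoverMatrix K (Fin n)) ∈
      Matrix.symplecticGroup (Fin (n + n)) K :=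
  reindex_sumCongr_mem_symplecticGroup _ K (cayleyMoverMatrix_mem K (Fin n))

/-- `κ_n` is defined over `ℤ[½]`: entrywise ring maps fix it. [cite: Kudla1994, §3] -/
theorem reindex_cayleyMoverMatrix_map {K' : Type*} [CommRing K'] [Invertible (2 : K')] (f : K →+* K') :
    (Matrix.reindex ((finSumFinEquiv (m := n) (n := n)).sumCongr (finSumFinEquiv (m := n) (n := n)))
        ((finSumFinEquiv (m := n) (n := n)).sumCongr (finSumFinEquiv (m := n) (n := n))) (cayleyMoverMatrix K (Fin n))).map f =
      Matrix.reindex ((finSumFinEquiv (m := n) (n := n)).sumCongr (finSumFinEquiv (m := n) (n := n)))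
        ((finSumFinEquiv (m := n) (n := n)).sumCongr (finSumFinEquiv (m := n) (n := n))) (cayleyMoverMatrix K' (Fin n)) := by
  rw [reindex_sumCongr_map, cayleyMoverMatrix_map]

/-- **the adelic ∕ base-changed `κ_n` is `mapHom f` of the rational one** (the shape ★ `ratSp = transportSp ∘ mapHom` consumes).
[cite: Kudla1994, §3] -/
theorem mapHom_reindex_cayleyMover {K' : Type*} [CommRing K'] [Invertible (2 : K')] (f : K →+* K') :
    mapHom f ⟨_, reindex_cayleyMoverMatrix_mem_symplecticGroup K n⟩ = ⟨_, reindex_cayleyMoverMatrix_mem_symplecticGroup K' n⟩ :=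
  Subtype.ext (by rw [coe_mapHom]; exact reindex_cayleyMoverMatrix_map K n f)

end Cayley

end Summit.HodgeConjecture.HodgeConjecture.Cruxes.HLiu418.K2LiuCayleyMoverFin

end
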